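import Summits.BirchSwinnertonDyer.Rank1Residual.X9.ArtinSplit5S4Certificate

/-!
# BSD rank-≤1 residual cell, class X9 — `5S4` Artin-split certificate, addendum: the explicit lift `R` REDUCES to `ρ̄`

HONEST FRAMING (cell `b2b-bsdres-*`, verbatim): the cell deletes COMBINATION-SHAPED residual classes of the rank-≤1 BSD formula
from PUBLISHED theorems only and TYPES the construction-shaped remainder; this is not "finishing BSD". Class X9 stays TYPED at
class level. This file books NOTHING. It completes `X9/ArtinSplit5S4Certificate.lean` (x9 GEN 34) by one kernel check that was
left in the docstring there: the explicit homomorphism `R : G → GL₂(ℤ[i])` (`G = 5S4 = N_{GL₂(𝔽₅)}(Q₈)`), reduced modulo the prime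
`(i − 2)` of `ℤ[i]` above 5 — the prime singled out by the records' convention `T(2) = i` — is conjugate, by the FIXED matrix
`C = [[1,1],[0,1]]`, to the tautological representation `G ⊂ GL₂(𝔽₅)`. Together with `R_mul` and `R_trace_det` there, `R` is thus THE
Brauer lift `ρ₀` of `ρ̄_{E,5}` for every `5S4` row, with nothing about lifting theorems left on paper. Unit `b2b-bsdres-x9`: written
GEN 34 (prover-b2b-bsdres-x9-g34-0, staged in `HOME/code/b2b-bsdres-x9/g34/lean5s4/`), proposed GEN 35 (prover-b2b-bsdres-x9-g35-0)
once the certificate file was in the tree; kernel-evaluated (`decide +kernel`; `#print axioms` empty).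
-/

set_option autoImplicit false

namespace Summit.BirchSwinnertonDyer.Rank1Residual.X9.ArtinSplit5S4

/-- reduction `ℤ[i] → 𝔽₅` at the prime `(i − 2)` above 5 (the one with `T(2) = i`): `a + bi ↦ a + 2b mod 5` -/
def ZI.red5 (x : ZI) : Nat := Int.toNat ((x.re + 2 * x.im) % 5)

/-- entrywise reduction of a matrix over `ℤ[i]` modulo `(i − 2)` -/
def MZ.red (m : MZ) : M2 := ⟨ZI.red5 m.e00, ZI.red5 m.e01, ZI.red5 m.e10, ZI.red5 m.e11⟩

/-- the change of basis `C = [[1,1],[0,1]]` relating the reduction of `R` to the tautological representation -/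
def Cbasis : M2 := ⟨1, 1, 0, 1⟩

/-- **`R` reduces to `ρ̄`**: for every `g ∈ G`, `C · (R(g) mod (i − 2)) · C⁻¹ = g` in `GL₂(𝔽₅)` — so `R` lifts (a conjugate of) the
tautological representation of `G = 5S4`; with `R_mul` / `R_trace_det` of the certificate file, `R` is the Brauer lift `ρ₀`. -/
theorem reduction : ∀ g ∈ Glist, M2.mul (M2.mul Cbasis (MZ.red (R g))) (M2.inv Cbasis) = g := by decide +kernel

end Summit.BirchSwinnertonDyer.Rank1Residual.X9.ArtinSplit5S4
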